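import Literature.Barriers.AtomisticToContinuum.OneDimensionalHardCoreModes
import Literature.Barriers.AtomisticToContinuum.OneDimensionalHardCoreBands
import Literature.Barriers.AtomisticToContinuum.OneDimensionalHardCoreRodsMajorant
import Mathlib.MeasureTheory.Integral.Prod
import HarnessLib

/-!
# The Girardeau gas: the one-body density matrix is positive semi-definite (Gram form)

`Literature/Barriers/AtomisticToContinuum` (D-0021 barrier catalogue, conjunct
`BoseEinsteinCondensation`). Companion of `OneDimensionalHardCore.lean` (statement file: the
Girardeau state `girardeauState`, its one-body density matrix `girardeauDensityMatrix` and the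
zero-momentum occupation `zeroMomentumOccupation`), `OneDimensionalHardCoreNarrow.lean` (the
quadratic form `girardeauForm N L φ = ⟨φ, γ_N φ⟩ = ∫₀ᴸ∫₀ᴸ conj(φ(x)) ρ_N(x, y) φ(y) dx dy` and
`modeNormSq`), `OneDimensionalHardCoreModes.lean` (Schur bound `|⟨φ, γ_N φ⟩| ≤ c₀(N)‖φ‖²`) and
`OneDimensionalHardCoreBands.lean` (plane-wave occupations `momentumOccupation N L m = c_m(N)`,
bands `bandOccupation N L M = B_M(N) = ∑_{|m| ≤ M} c_m(N)`, `|c_m| ≤ c₀`, `|B_M| ≤ 8e√N√(2M+1)`).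

This file (twelfth barrier audit, 2026-08-16) types the item listed as outstanding in the
catalogue entry's caveat (p)(4) — "the positivity `c_m ≥ 0` / positive-semidefiniteness of `γ_N`
as a typed statement (only `|c_m| ≤ c₀` and the `|B_M|` bound are typed)":

* `girardeauForm_succ_eq_gram`: for every `φ ∈ L¹[0, L]` (no sign or size condition on `L`),
  `⟨φ, γ_{n+1} φ⟩ = (n + 1) ∫_{[0,L]^n} |∫₀ᴸ ψ_{n+1}(X, y) φ(y) dy|² dX` — the one-body density
  matrix `ρ_N(x, y) = N ∫ ψ_N(X, x) ψ_N(X, y) dX` [ForresterEtAl2003, §2.1.2] is the Gram kernel of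
  the family `X ↦ ψ_N(X, ·)`, which is exactly the shape of the conjunct's `occupation`
  (`N ∫ |∫ conj(φ) Ψ|² dX`, `Literature.MathematicalPhysics.QuantumManyBody.BoseGas.occupation`);
  proof: two Fubini swaps on `[0, L] × [0, L] × [0, L]^n`, legitimate because the Girardeau state is
  continuous and bounded (`|ψ_N| ≤ (N! L^N)^{-1/2} 2^{N²}`) and `φ ∈ L¹`;
* hence `Im⟨φ, γ_N φ⟩ = 0`, `Re⟨φ, γ_N φ⟩ ≥ 0` (`girardeauForm_im_eq_zero`,
  `girardeauForm_re_nonneg`), and for the `L²[0, L]` modes of the Narrow/Modes companions the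
  spectrum statement `0 ≤ ⟨φ, γ_N φ⟩ ≤ c₀(N)‖φ‖²` (`girardeauForm_re_mem_Icc`, with the Modes
  companion's Schur bound): `λ_min(γ_N) ≥ 0`, `λ_max(γ_N) = c₀(N)`;
* for the plane waves: `0 ≤ c_m(N) ≤ c₀(N)` (`momentumOccupation_mem_Icc`), `B_M(N) ≥ 0`,
  `M ↦ B_M(N)` monotone and `c₀(N) ≤ B_M(N)` (`bandOccupation_mono`,
  `zeroMomentumOccupation_le_bandOccupation`), so the Bands companion's law reads two-sidedly
  `c₀(N) ≤ B_M(N) ≤ 8e√N√(2M+1)`.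

Printed context: on the circle the natural orbitals are the plane waves and their occupations are
the (non-negative) momentum distribution `c_n(N)`, `∑_n c_n(N) = N` [ForresterEtAl2003, §2.2.1,
§3.1]; the Parseval identity `∑_m c_m(N) = N` is NOT typed here (it needs Fourier series on
`[0, L]`, see the catalogue entry's caveat list).

## References

* [ForresterEtAl2003] P. J. Forrester, N. E. Frankel, T. M. Garoni, N. S. Witte, *Finite
  one-dimensional impenetrable Bose systems: occupation numbers*, Phys. Rev. A 67 (2003) 043607,
  arXiv:cond-mat/0211126: §2.1.2 (`ρ_N` as an `N`-fold integral of `ψ_N ψ_N`), §2.2.1 (`c_n(N)`,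
  `∑ c_n = N`), §3.1 (natural orbitals on the circle = plane waves).

## Design notes

No definition and no named fact is introduced (D-0026): every result is a `theorem` about the
objects of the statement file and of the Narrow / Bands companions (finiteness of Lebesgue
measure on `[0, L]^n`, needed for the Fubini bookkeeping, is the theorem
`isFiniteMeasure_restrict_box`, invoked by `haveI`, not an instance). Continuity of the Girardeau
state is re-used from
`OneDimensionalHardCoreRodsMajorant.lean` (`continuous_girardeauState`).
-/

noncomputable section

open MeasureTheory Filter Topology Finset Complex
open scoped BigOperators Real ComplexConjugate

namespace Literature.Barriers.AtomisticToContinuum.BoseGas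

variable {n : ℕ} {L : ℝ}

/-! ### Measurability and integrability of the smeared Girardeau state -/

/-- `(X, y) ↦ ψ_{n+1}(X, y)` is jointly continuous. [folklore] -/
theorem continuous_girardeauState_snoc (n : ℕ) (L : ℝ) :
    Continuous fun p : (Fin n → ℝ) × ℝ => girardeauState (n + 1) L (Fin.snoc p.1 p.2) :=
  (continuous_girardeauState (n + 1) L).comp
    (Continuous.finSnoc (A := fun _ : Fin (n + 1) => ℝ) continuous_fst continuous_snd)

/-- The crude uniform bound `0 ≤ ψ_N ≤ (N! L^N)^{-1/2} 2^{N²}`. [folklore] -/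
theorem girardeauState_le_crude (N : ℕ) (L : ℝ) (Y : Fin N → ℝ) :
    girardeauState N L Y ≤ (Real.sqrt (N.factorial * L ^ N))⁻¹ * 2 ^ (N * N) := by
  unfold girardeauState
  refine mul_le_mul_of_nonneg_left ?_ (inv_nonneg.mpr (Real.sqrt_nonneg _))
  calc ∏ j : Fin N, ∏ k : Fin N with j < k, 2 * |Real.sin (Real.pi * (Y k - Y j) / L)|
      ≤ ∏ j : Fin N, ∏ k : Fin N with j < k, (2 : ℝ) := by
        refine Finset.prod_le_prod (fun j _ => Finset.prod_nonneg fun k _ => by positivity)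
          fun j _ => Finset.prod_le_prod (fun k _ => by positivity) fun k _ => ?_
        have := Real.abs_sin_le_one (Real.pi * (Y k - Y j) / L)
        linarith
    _ ≤ ∏ _j : Fin N, (2 : ℝ) ^ N := by
        refine Finset.prod_le_prod (fun j _ => Finset.prod_nonneg fun k _ => by positivity)
          fun j _ => ?_
        rw [Finset.prod_const]
        exact pow_le_pow_right₀ (by norm_num) ((Finset.card_filter_le _ _).trans (by simp))
    _ = 2 ^ (N * N) := by
        rw [Finset.prod_const, Finset.card_univ, Fintype.card_fin, ← pow_mul]

/-- Lebesgue measure restricted to the box `[0, L]^n` is finite (a `theorem`, used via `haveI`;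
no instance is registered; the box is compact, cf. `volume_box_lt_top` of the Neumann-rods
companion). [folklore] -/
theorem isFiniteMeasure_restrict_box (n : ℕ) (L : ℝ) :
    IsFiniteMeasure ((volume : Measure (Fin n → ℝ)).restrict
      (Set.pi Set.univ fun _ : Fin n => Set.Icc (0 : ℝ) L)) :=
  isFiniteMeasure_restrict.mpr
    ((isCompact_univ_pi fun _ => isCompact_Icc).measure_lt_top (μ := volume)).ne

/-- For `φ ∈ L¹[0, L]`, `(X, y) ↦ ψ_{n+1}(X, y) φ(y)` is integrable on `[0,L]^n × [0,L]`.
[folklore] -/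
theorem integrable_girardeauState_snoc_mul (n : ℕ) (L : ℝ) {φ : ℝ → ℂ}
    (hφ : IntegrableOn φ (Set.Icc 0 L)) :
    Integrable (fun p : (Fin n → ℝ) × ℝ =>
        (girardeauState (n + 1) L (Fin.snoc p.1 p.2) : ℂ) * φ p.2)
      (((volume : Measure (Fin n → ℝ)).restrict
          (Set.pi Set.univ fun _ : Fin n => Set.Icc (0 : ℝ) L)).prod
        (volume.restrict (Set.Icc (0 : ℝ) L))) := by
  set μ : Measure (Fin n → ℝ) := volume.restrict (Set.pi Set.univ fun _ : Fin n => Set.Icc (0 : ℝ) L)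
  set ν : Measure ℝ := volume.restrict (Set.Icc (0 : ℝ) L)
  haveI : IsFiniteMeasure μ := isFiniteMeasure_restrict_box n L
  set B : ℝ := (Real.sqrt ((n + 1).factorial * L ^ (n + 1)))⁻¹ * 2 ^ ((n + 1) * (n + 1)) with hB
  have hg : Integrable (fun p : (Fin n → ℝ) × ℝ => B * ‖φ p.2‖) (μ.prod ν) :=
    (hφ.norm.const_mul B).comp_snd μ
  refine hg.mono' ?_ (Filter.Eventually.of_forall fun p => ?_)
  · exact (Complex.continuous_ofReal.comp (continuous_girardeauState_snoc n L)).aestronglyMeasurable.mul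
      (hφ.aestronglyMeasurable.comp_snd)
  · rw [norm_mul, Complex.norm_real, Real.norm_eq_abs,
      abs_of_nonneg (girardeauState_nonneg _ _ _)]
    exact mul_le_mul_of_nonneg_right (girardeauState_le_crude _ _ _) (norm_nonneg _)

/-! ### The Gram form of `⟨φ, γ_N φ⟩` -/

/-- **Gram form of the one-body density matrix.** For every `L`, every `n` and every
`φ ∈ L¹[0, L]`,
`⟨φ, γ_{n+1} φ⟩ = (n + 1) ∫_{[0,L]^n} |∫₀ᴸ ψ_{n+1}(X, y) φ(y) dy|² dX`:
the one-body density matrix `γ_N(x, y) = N ∫ Ψ(X, x) Ψ(X, y) dX` is the Gram kernel of the family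
`X ↦ Ψ(X, ·)`, hence positive semi-definite. (Fubini on `[0,L] × [0,L] × [0,L]^n`; the Girardeau
state is bounded and continuous.) [cite: ForresterEtAl2003, §2.1.2] -/
theorem girardeauForm_succ_eq_gram (n : ℕ) (L : ℝ) {φ : ℝ → ℂ}
    (hφ : IntegrableOn φ (Set.Icc 0 L)) :
    girardeauForm (n + 1) L φ =
      (((n + 1 : ℝ) * ∫ X in Set.pi Set.univ (fun _ : Fin n => Set.Icc (0 : ℝ) L),
          ‖∫ y in Set.Icc 0 L, (girardeauState (n + 1) L (Fin.snoc X y) : ℂ) * φ y‖ ^ 2 : ℝ) :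
        ℂ) := by
  set S : Set (Fin n → ℝ) := Set.pi Set.univ (fun _ : Fin n => Set.Icc (0 : ℝ) L) with hS
  set μ : Measure (Fin n → ℝ) := volume.restrict S with hμ
  set ν : Measure ℝ := volume.restrict (Set.Icc (0 : ℝ) L) with hν
  set ψ : (Fin n → ℝ) → ℝ → ℂ := fun X y => (girardeauState (n + 1) L (Fin.snoc X y) : ℂ) with hψ
  set A : (Fin n → ℝ) → ℂ := fun X => ∫ y, ψ X y * φ y ∂ν with hA
  haveI : IsFiniteMeasure μ := isFiniteMeasure_restrict_box n L
  set B : ℝ := (Real.sqrt ((n + 1).factorial * L ^ (n + 1)))⁻¹ * 2 ^ ((n + 1) * (n + 1)) with hB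
  have hψB : ∀ X y, ‖ψ X y‖ ≤ B := fun X y => by
    rw [hψ, Complex.norm_real, Real.norm_eq_abs, abs_of_nonneg (girardeauState_nonneg _ _ _)]
    exact girardeauState_le_crude _ _ _
  have hψc : Continuous (Function.uncurry ψ) :=
    Complex.continuous_ofReal.comp (continuous_girardeauState_snoc n L)
  -- the basic integrable function `(X, y) ↦ ψ(X, y) φ(y)` and its marginal `A`
  have hI : Integrable (fun p : (Fin n → ℝ) × ℝ => ψ p.1 p.2 * φ p.2) (μ.prod ν) :=
    integrable_girardeauState_snoc_mul n L hφ
  have hAint : Integrable A μ := hI.integral_prod_left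
  -- Step 0: the density matrix as an `X`-integral
  have hdens : ∀ x y : ℝ, (girardeauDensityMatrix (n + 1) L x y : ℂ) =
      (n + 1 : ℂ) * ∫ X, ψ X x * ψ X y ∂μ := by
    intro x y
    have hdef : girardeauDensityMatrix (n + 1) L x y = (n + 1 : ℝ) *
        ∫ X in S, girardeauState (n + 1) L (Fin.snoc X x) *
          girardeauState (n + 1) L (Fin.snoc X y) := rfl
    rw [hdef, Complex.ofReal_mul, ← integral_complex_ofReal]
    push_cast
    rfl
  -- Step 1: the integrand of the form, pointwise
  have hinner : ∀ x y : ℝ,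
      conj (φ x) * (girardeauDensityMatrix (n + 1) L x y : ℂ) * φ y =
        (n + 1 : ℂ) * ∫ X, (conj (φ x) * ψ X x) * (ψ X y * φ y) ∂μ := by
    intro x y
    rw [hdens, show conj (φ x) * ((n + 1 : ℂ) * ∫ X, ψ X x * ψ X y ∂μ) * φ y =
      (n + 1 : ℂ) * (conj (φ x) * (∫ X, ψ X x * ψ X y ∂μ) * φ y) by ring,
      ← integral_const_mul, ← integral_mul_const]
    congr 1
    refine integral_congr_ae (Filter.Eventually.of_forall fun X => ?_)
    simp only
    ring
  -- Step 2: Fubini in `(y, X)` for each fixed `x`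
  have hswap1 : ∀ x : ℝ,
      ∫ y, ∫ X, (conj (φ x) * ψ X x) * (ψ X y * φ y) ∂μ ∂ν =
        ∫ X, (conj (φ x) * ψ X x) * A X ∂μ := by
    intro x
    have hJ : Integrable (Function.uncurry fun (y : ℝ) (X : Fin n → ℝ) =>
        (conj (φ x) * ψ X x) * (ψ X y * φ y)) (ν.prod μ) := by
      have h1 : Integrable (fun p : ℝ × (Fin n → ℝ) => ψ p.2 p.1 * φ p.1) (ν.prod μ) := hI.swap
      refine h1.bdd_mul (c := ‖φ x‖ * B) ?_ (Filter.Eventually.of_forall fun p => ?_)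
      · exact (continuous_const.mul (hψc.comp (continuous_snd.prodMk continuous_const))).aestronglyMeasurable
      · rw [norm_mul, Complex.norm_conj]
        exact mul_le_mul_of_nonneg_left (hψB _ _) (norm_nonneg _)
    rw [integral_integral_swap hJ]
    refine integral_congr_ae (Filter.Eventually.of_forall fun X => ?_)
    simp only
    rw [integral_const_mul]
  -- Step 3: Fubini in `(x, X)`
  have hK : Integrable (Function.uncurry fun (x : ℝ) (X : Fin n → ℝ) =>
      (conj (φ x) * ψ X x) * A X) (ν.prod μ) := by
    have hmaj : Integrable (fun p : ℝ × (Fin n → ℝ) => (B * ‖φ p.1‖) * ‖A p.2‖) (ν.prod μ) :=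
      (hφ.norm.const_mul B).mul_prod hAint.norm
    refine hmaj.mono' ?_ (Filter.Eventually.of_forall ?_)
    · exact ((Complex.continuous_conj.comp_aestronglyMeasurable hφ.aestronglyMeasurable).comp_fst.mul
        (hψc.comp (continuous_snd.prodMk continuous_fst)).aestronglyMeasurable).mul
        hAint.aestronglyMeasurable.comp_snd
    · rintro ⟨x, X⟩
      simp only [Function.uncurry_apply_pair]
      rw [norm_mul, norm_mul, Complex.norm_conj]
      refine mul_le_mul_of_nonneg_right ?_ (norm_nonneg _)
      rw [mul_comm]
      exact mul_le_mul_of_nonneg_right (hψB _ _) (norm_nonneg _)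
  have hswap2 : ∫ x, ∫ X, (conj (φ x) * ψ X x) * A X ∂μ ∂ν =
      ∫ X, conj (A X) * A X ∂μ := by
    rw [integral_integral_swap hK]
    refine integral_congr_ae (Filter.Eventually.of_forall fun X => ?_)
    simp only
    rw [integral_mul_const, hA]
    congr 1
    rw [← integral_conj]
    refine integral_congr_ae (Filter.Eventually.of_forall fun x => ?_)
    simp only [map_mul, hψ, Complex.conj_ofReal]
    ring
  -- Step 4: assemble
  calc girardeauForm (n + 1) L φ
      = ∫ x, ∫ y, conj (φ x) * (girardeauDensityMatrix (n + 1) L x y : ℂ) * φ y ∂ν ∂ν := rfl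
    _ = ∫ x, ∫ y, (n + 1 : ℂ) * ∫ X, (conj (φ x) * ψ X x) * (ψ X y * φ y) ∂μ ∂ν ∂ν := by
        simp_rw [hinner]
    _ = (n + 1 : ℂ) * ∫ x, ∫ X, (conj (φ x) * ψ X x) * A X ∂μ ∂ν := by
        simp_rw [integral_const_mul, hswap1]
    _ = (n + 1 : ℂ) * ∫ X, conj (A X) * A X ∂μ := by rw [hswap2]
    _ = (n + 1 : ℂ) * ∫ X, ((‖A X‖ ^ 2 : ℝ) : ℂ) ∂μ := by
        congr 1
        refine integral_congr_ae (Filter.Eventually.of_forall fun X => ?_)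
        simp only
        rw [RCLike.conj_mul]
        push_cast
        rfl
    _ = _ := by
        rw [integral_complex_ofReal]
        push_cast
        rfl


/-! ### Positivity: `γ_N ≥ 0` as a quadratic form -/

/-- **The one-body density matrix of Girardeau's state is positive semi-definite**: for every
`N`, `L` and every `φ ∈ L¹[0, L]`, `⟨φ, γ_N φ⟩` is a non-negative real number — here its
imaginary part vanishes. [cite: ForresterEtAl2003, §2.1.2] -/
theorem girardeauForm_im_eq_zero (N : ℕ) (L : ℝ) {φ : ℝ → ℂ} (hφ : IntegrableOn φ (Set.Icc 0 L)) :
    (girardeauForm N L φ).im = 0 := by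
  cases N with
  | zero => simp [girardeauForm, girardeauDensityMatrix]
  | succ n => rw [girardeauForm_succ_eq_gram n L hφ, Complex.ofReal_im]

/-- **The one-body density matrix of Girardeau's state is positive semi-definite**: for every
`N`, `L` and every `φ ∈ L¹[0, L]`, `Re⟨φ, γ_N φ⟩ ≥ 0` (and `Im⟨φ, γ_N φ⟩ = 0`,
`girardeauForm_im_eq_zero`). [cite: ForresterEtAl2003, §2.1.2] -/
theorem girardeauForm_re_nonneg (N : ℕ) (L : ℝ) {φ : ℝ → ℂ} (hφ : IntegrableOn φ (Set.Icc 0 L)) :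
    0 ≤ (girardeauForm N L φ).re := by
  cases N with
  | zero => simp [girardeauForm, girardeauDensityMatrix]
  | succ n =>
      rw [girardeauForm_succ_eq_gram n L hφ, Complex.ofReal_re]
      exact mul_nonneg (by positivity) (integral_nonneg fun X => by positivity)

/-- For `φ ∈ L¹[0, L]` the form is its own real part: `⟨φ, γ_N φ⟩ = Re⟨φ, γ_N φ⟩ ≥ 0`. [folklore] -/
theorem girardeauForm_eq_re (N : ℕ) (L : ℝ) {φ : ℝ → ℂ} (hφ : IntegrableOn φ (Set.Icc 0 L)) :
    girardeauForm N L φ = ((girardeauForm N L φ).re : ℂ) :=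
  Complex.ext (by simp) (by simp [girardeauForm_im_eq_zero N L hφ])

/-- For `φ ∈ L¹[0, L]`, `‖⟨φ, γ_N φ⟩‖ = Re⟨φ, γ_N φ⟩`. [folklore] -/
theorem norm_girardeauForm_eq_re (N : ℕ) (L : ℝ) {φ : ℝ → ℂ} (hφ : IntegrableOn φ (Set.Icc 0 L)) :
    ‖girardeauForm N L φ‖ = (girardeauForm N L φ).re := by
  rw [girardeauForm_eq_re N L hφ, Complex.norm_real, Complex.ofReal_re, Real.norm_eq_abs,
    abs_of_nonneg (girardeauForm_re_nonneg N L hφ)]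

/-! ### The `L²` class of the Narrow/Modes companions -/

/-- An `L²[0, L]` mode (a.e.-strongly measurable with `|φ|²` integrable, the class of
`OneDimensionalHardCoreNarrow`) is in `L¹[0, L]`. [folklore] -/
theorem integrableOn_Icc_of_sq_integrable {L : ℝ} {φ : ℝ → ℂ}
    (hφm : AEStronglyMeasurable φ (volume.restrict (Set.Icc (0 : ℝ) L)))
    (hφ : IntegrableOn (fun x => ‖φ x‖ ^ 2) (Set.Icc 0 L)) :
    IntegrableOn φ (Set.Icc 0 L) :=
  ((memLp_two_iff_integrable_sq_norm hφm).2 hφ).integrable one_le_two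

/-- **The spectrum of `γ_N` lies in `[0, c₀(N)]`.** For `L > 0`, every `N` and every `L²[0, L]`
mode `φ`: `0 ≤ ⟨φ, γ_N φ⟩ ≤ c₀(N)‖φ‖²` — positivity (this file) and the Schur bound
`norm_girardeauForm_le_zeroMomentumOccupation` of the Modes companion; the upper end is attained at
the constant mode (`girardeauForm_const_one`), i.e. `λ_max(γ_N) = c₀(N)` and `γ_N ≥ 0`.
[cite: ForresterEtAl2003, §2.2.1–2.2.2] -/
theorem girardeauForm_re_mem_Icc (hL : 0 < L) (N : ℕ) {φ : ℝ → ℂ}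
    (hφm : AEStronglyMeasurable φ (volume.restrict (Set.Icc (0 : ℝ) L)))
    (hφ : IntegrableOn (fun x => ‖φ x‖ ^ 2) (Set.Icc 0 L)) :
    (girardeauForm N L φ).re ∈ Set.Icc 0 (zeroMomentumOccupation N L * modeNormSq L φ) := by
  have h1 := integrableOn_Icc_of_sq_integrable hφm hφ
  refine ⟨girardeauForm_re_nonneg N L h1, ?_⟩
  rw [← norm_girardeauForm_eq_re N L h1]
  exact norm_girardeauForm_le_zeroMomentumOccupation hL N φ hφ


/-! ### Momentum occupations are non-negative; bands grow with their width -/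

/-- **`c_m(N) ≥ 0`**: every plane-wave occupation of Girardeau's state is non-negative (the sign
left untyped by the Bands companion, whose `abs_momentumOccupation_le` gives `|c_m| ≤ c₀`).
[cite: ForresterEtAl2003, §2.2.1] -/
theorem momentumOccupation_nonneg (hL : 0 < L) (N : ℕ) (m : ℤ) :
    0 ≤ momentumOccupation N L m :=
  mul_nonneg (inv_nonneg.mpr hL.le)
    (girardeauForm_re_nonneg N L ((continuous_ez L m).integrableOn_Icc))

/-- **`0 ≤ c_m(N) ≤ c₀(N)`**: the zero mode is the most occupied one and no occupation is
negative. [cite: ForresterEtAl2003, §2.2.1–2.2.2] -/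
theorem momentumOccupation_mem_Icc (hL : 0 < L) (N : ℕ) (m : ℤ) :
    momentumOccupation N L m ∈ Set.Icc 0 (zeroMomentumOccupation N L) :=
  ⟨momentumOccupation_nonneg hL N m, (le_abs_self _).trans (abs_momentumOccupation_le hL N m)⟩

/-- Adding one shell: `B_{M+1}(N) = B_M(N) + c_{M+1}(N) + c_{-(M+1)}(N)`. [folklore] -/
theorem bandOccupation_succ (N : ℕ) (L : ℝ) (M : ℕ) :
    bandOccupation N L (M + 1) =
      bandOccupation N L M + momentumOccupation N L ((M : ℤ) + 1) +
        momentumOccupation N L (-((M : ℤ) + 1)) := by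
  unfold bandOccupation
  rw [show 2 * (M + 1) + 1 = (2 * M + 1) + 1 + 1 by ring, Finset.sum_range_succ,
    Finset.sum_range_succ']
  have h1 : ∀ k : ℕ, ((k + 1 : ℕ) : ℤ) - ((M + 1 : ℕ) : ℤ) = (k : ℤ) - M := fun k => by
    push_cast; ring
  have h2 : (((2 * M + 1 : ℕ) : ℤ) - (M : ℤ)) = (M : ℤ) + 1 := by push_cast; ring
  have h3 : (((0 : ℕ) : ℤ) - ((M + 1 : ℕ) : ℤ)) = -((M : ℤ) + 1) := by push_cast; ring
  simp_rw [h1]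
  rw [h2, h3]
  ring

/-- **Bands are non-negative**: `B_M(N) ≥ 0`. [cite: ForresterEtAl2003, §2.2.1] -/
theorem bandOccupation_nonneg (hL : 0 < L) (N M : ℕ) : 0 ≤ bandOccupation N L M :=
  Finset.sum_nonneg fun _ _ => momentumOccupation_nonneg hL N _

/-- **Bands grow with their width**: `M ↦ B_M(N)` is monotone. [cite: ForresterEtAl2003, §2.2.1] -/
theorem bandOccupation_mono (hL : 0 < L) (N : ℕ) : Monotone (bandOccupation N L) := by
  refine monotone_nat_of_le_succ fun M => ?_
  rw [bandOccupation_succ]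
  have h1 := momentumOccupation_nonneg hL N ((M : ℤ) + 1)
  have h2 := momentumOccupation_nonneg hL N (-((M : ℤ) + 1))
  linarith

/-- **Two-sided band law**: `c₀(N) ≤ B_M(N) ≤ 8e√N√(2M+1)` for all `N`, `M`, `L > 0` (lower end:
positivity, this file; upper end: `bandOccupation_le_sqrt` of the Bands companion).
[cite: ForresterEtAl2003, §2.2.1–2.2.2] -/
theorem zeroMomentumOccupation_le_bandOccupation (hL : 0 < L) (N M : ℕ) :
    zeroMomentumOccupation N L ≤ bandOccupation N L M := by
  rw [← bandOccupation_zero hL N]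
  exact bandOccupation_mono hL N (Nat.zero_le M)

end Literature.Barriers.AtomisticToContinuum.BoseGas
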